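import Summits.MatrixMultiplication.OmegaCensus.BoxUsefulCentreLift
import Summits.MatrixMultiplication.OmegaCensus.BoxUsefulCentreLiftCoord

/-!
# ω-census, family (b3): conjecture C9 (b) — the law lifts through box-useful central extensions (all four classes)

HONEST FRAMING (pub-omega census; verbatim): lottery ticket; floor = certified bounds/negative ranges.
Census BOOKKEEPING (conjecture C9 of the cell, STRUCTURE.md §2; pub-omega kernel-l4 gen 16, task K-5, structure part):
assembly of `BoxUsefulNilpotentLaw` (g15: classes `1`, `4`), `BoxUsefulCentreLift` (class `6`) and `BoxUsefulCentreLiftCoord`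
(class `𝒞₂`).

**Theorem (`CentreLift.lawful_of_quotient_lawful`).** If `G` is finite and box-useful and its central quotient `G/Z(G)`
satisfies the conclusion of `BoxRatioSectionLaw` (centre index `1`, `4` or `6`, or a `Coord2` package), then so does `G`.
**Corollary (the reduction).** Since `G/Z(G)` is box-useful whenever `G` is (C9 (a), `BoxUseful.quotient`), C9 (b) holds for a
box-useful group as soon as it holds for some term of its upper central quotient tower — in particular C9 (b) for ALL finite
groups reduces to C9 (b) for CENTRELESS box-useful groups (`Z(G) = 1`), where the remaining objects are: minimal normal
subgroups acted on faithfully (the landed endpoint configurations `KleinRot`, `D18`, `DihC3Cube`, `S3S3`, `C3C3C4`) and the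
Schmidt atoms (stpp-1).  Nothing here is progress on `ω`.
-/

namespace Summit.MatrixMultiplication.OmegaCensus

open Finset ProductBoxBound
open scoped commutatorElement

namespace CentreLift

variable {G : Type*} [Group G] [Fintype G] [DecidableEq G]

omit [Fintype G] [DecidableEq G] in
/-- If `Z(G/Z(G))` has index `1` or `4` then `G` is nilpotent (of class `≤ 3`). [folklore] -/
theorem isNilpotent_of_quotient_index (h14 : (Subgroup.center (G ⧸ Subgroup.center G)).index = 1 ∨
    (Subgroup.center (G ⧸ Subgroup.center G)).index = 4) : Group.IsNilpotent G := by
  classical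
  haveI : Fact (Nat.Prime 2) := ⟨Nat.prime_two⟩
  -- `Q = (G/Z)/Z(G/Z)` is abelian (order `1` or `4 = 2²`)
  have hcomm : ∀ a b : (G ⧸ Subgroup.center G) ⧸ Subgroup.center (G ⧸ Subgroup.center G), a * b = b * a := by
    rcases h14 with h1 | h4
    · intro a b
      have htop : Subgroup.center (G ⧸ Subgroup.center G) = ⊤ := Subgroup.index_eq_one.mp h1
      obtain ⟨x, rfl⟩ := QuotientGroup.mk_surjective a
      have hx : (x : (G ⧸ Subgroup.center G) ⧸ Subgroup.center (G ⧸ Subgroup.center G)) = 1 := by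
        rw [QuotientGroup.eq_one_iff, htop]; exact Subgroup.mem_top x
      rw [hx, one_mul, mul_one]
    · exact (IsPGroup.isMulCommutative_of_card_eq_prime_sq (p := 2)
        (by rw [← Subgroup.index_eq_card, h4]; norm_num)).is_comm.comm
  -- hence `G/Z` is nilpotent of class `≤ 2`
  haveI : Group.IsNilpotent (G ⧸ Subgroup.center G) := ⟨⟨2, by
    rw [eq_top_iff]
    intro x _
    rw [Subgroup.mem_upperCentralSeries_succ_iff]
    intro y
    rw [Subgroup.upperCentralSeries_one, ← QuotientGroup.eq_one_iff, commutatorElement_def, QuotientGroup.mk_mul,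
      QuotientGroup.mk_mul, QuotientGroup.mk_mul, QuotientGroup.mk_inv, QuotientGroup.mk_inv, hcomm (x : _ ⧸ _) y]
    group⟩⟩
  exact Subgroup.isNilpotent_of_ker_le_center (QuotientGroup.mk' (Subgroup.center G)) (by rw [QuotientGroup.ker_mk'])

/-- **The law lifts through box-useful central extensions.** If `G` is box-useful and `G/Z(G)` satisfies the conclusion of
C9 (b), then so does `G`. [folklore] -/
theorem lawful_of_quotient_lawful (hG : BoxUseful G)
    (hq : (Subgroup.center (G ⧸ Subgroup.center G)).index = 1 ∨ (Subgroup.center (G ⧸ Subgroup.center G)).index = 4 ∨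
      (Subgroup.center (G ⧸ Subgroup.center G)).index = 6 ∨
      ∃ (c₁ c₂ : G ⧸ Subgroup.center G) (κ₁ κ₂ ε : (G ⧸ Subgroup.center G) → ZMod 3), DihC3Sq.Coord2 c₁ c₂ κ₁ κ₂ ε) :
    (Subgroup.center G).index = 1 ∨ (Subgroup.center G).index = 4 ∨ (Subgroup.center G).index = 6 ∨
      ∃ (c₁ c₂ : G) (κ₁ κ₂ ε : G → ZMod 3), DihC3Sq.Coord2 c₁ c₂ κ₁ κ₂ ε := by
  rcases hq with h1 | h4 | h6 | ⟨c₁, c₂, κ₁, κ₂, ε, h⟩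
  · haveI := isNilpotent_of_quotient_index (G := G) (Or.inl h1)
    exact TwoGroup.boxRatioSectionLaw_of_isNilpotent hG
  · haveI := isNilpotent_of_quotient_index (G := G) (Or.inr h4)
    exact TwoGroup.boxRatioSectionLaw_of_isNilpotent hG
  · exact Or.inr (Or.inr (Or.inl (index_center_eq_six hG h6)))
  · exact lawful_of_coord2_quotient hG h

/-- The same with the quotient hypothesis phrased through `BoxUseful (G ⧸ Z(G))`: C9 (b) for `G` follows from C9 (b) applied to
the (box-useful) central quotient. [folklore] -/
theorem lawful_of_law_on_quotient (hG : BoxUseful G)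
    (hlaw : BoxUseful (G ⧸ Subgroup.center G) →
      ((Subgroup.center (G ⧸ Subgroup.center G)).index = 1 ∨ (Subgroup.center (G ⧸ Subgroup.center G)).index = 4 ∨
        (Subgroup.center (G ⧸ Subgroup.center G)).index = 6 ∨
        ∃ (c₁ c₂ : G ⧸ Subgroup.center G) (κ₁ κ₂ ε : (G ⧸ Subgroup.center G) → ZMod 3), DihC3Sq.Coord2 c₁ c₂ κ₁ κ₂ ε)) :
    (Subgroup.center G).index = 1 ∨ (Subgroup.center G).index = 4 ∨ (Subgroup.center G).index = 6 ∨
      ∃ (c₁ c₂ : G) (κ₁ κ₂ ε : G → ZMod 3), DihC3Sq.Coord2 c₁ c₂ κ₁ κ₂ ε := by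
  classical
  exact lawful_of_quotient_lawful hG (hlaw (hG.quotient (Subgroup.center G)))

end CentreLift

end Summit.MatrixMultiplication.OmegaCensus
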